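/-
NEW (pub-hodgecm2, COR-CM cell = stage 2 of the Hodge ladder; MODEL-UNIVERSE BUILDER 1 = seat model-1, gen 2).
Capstone of the model layer: the CLOSED 28-field record `ModelAxioms` of the Picard–CM model universe over the
displayed binders only — row M22 `Fact_algDuality` is now the tree theorem `Model.universeOf_algDuality`
(`CorCM/Model/AlgDualityHolds.lean`), so the hypothesis `h28` of `Model.modelAxioms_of_rows`
(`CorCM/Model/ModelAxiomsOfRows.lean`, row P7 part 1) is discharged.  Count-neutral (no BINDER row changes);
recorded so that consumers other than the E-term assembly can name the model's `ModelAxioms` directly.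
-/
import Summits.HodgeConjecture.CorCM.Model.ModelAxiomsOfRows
import Summits.HodgeConjecture.CorCM.Model.AlgDualityHolds
import HarnessLib

/-!
# COR-CM — the model universe satisfies `ModelAxioms`, modulo Riemann's theorem only

For the Picard–CM model universe `U₀ := Model.universeOf hHD hI hU h₃` (`CorCM/Model/Universe.lean`) the structural
record `U₀.ModelAxioms` (`CorCM/Geometry/Facts.lean`, 28 fields M01–M28 of stage 1's `MODEL-SCOPE.md`) holds, given
only the displayed data `hHD hI hU h₃` and stage 1's cited record `hR : DeligneMilne1982_Thm_6_20_full`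
(binder B02 of `HOME/BINDER-OWNERS.md`; it enters through rows M20 `cmDominated` and M21 `conjIsogeny` only).

* `Model.modelAxioms_of_riemann` — `Model.modelAxioms_of_rows` (b10, every field the junction theorem of its row:
  model-1 `Model/ModelFacts.lean`, model-2 `Model/PerLConeFacts.lean`, b18 `Model/CMDominated.lean`,
  p2 `Model/ExteriorAlgebraFacts.lean`, b12 `Model/WeilLineHodge.lean`) with its one named hypothesis `h28` filled by
  model-1's unconditional plug `Model.universeOf_algDuality` (row M22, Lieberman-type duality realised by the
  Fourier word sum of the polar basis of a Rosati-compatible algebraic polarisation of the corner product).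
* `Model.picardCMUniverse_modelAxioms_of_riemann` — the same for the model of record
  `Model.picardCMUniverse hHD hI h₁ h₃ = universeOf hHD hI (ballQuotientUniformisedDatum_of h₁) h₃` (`rfl`).

Nothing is asserted: every field is a hub-tree theorem; axioms `propext`, `Classical.choice`, `Quot.sound`.
-/

noncomputable section

namespace Summit.HodgeConjecture.CorCM

open Literature.NumberTheory.Automorphic.PicardCM
open Literature.AlgebraicGeometry.HodgeTheory

namespace Model

/-- **The Picard–CM model universe satisfies `ModelAxioms`, modulo Riemann's theorem** (Deligne–Milne 1982 Thm 6.20,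
stage 1's cited record `hR`, used by rows M20/M21 only): all 28 fields of `(universeOf hHD hI hU h₃).ModelAxioms` are
tree theorems — `modelAxioms_of_rows` with row M22 `Fact_algDuality` supplied by `universeOf_algDuality`. -/
theorem modelAxioms_of_riemann (hHD : exists_isReal_hodgeModel) (hI : hodgePQ_independent_of_hodgeModel)
    (hU : BallQuotientUniformisedDatum) (h₃ : CMAbelianVarietyRealised) (hR : DeligneMilne1982_Thm_6_20_full) :
    (universeOf hHD hI hU h₃).ModelAxioms :=
  modelAxioms_of_rows hHD hI hU h₃ hR (universeOf_algDuality hHD hI hU h₃)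

/-- **The model of record satisfies `ModelAxioms`, modulo Riemann's theorem**: the same statement for
`Model.picardCMUniverse hHD hI h₁ h₃` (which is `universeOf hHD hI (ballQuotientUniformisedDatum_of h₁) h₃` by `rfl`). -/
theorem picardCMUniverse_modelAxioms_of_riemann (hHD : exists_isReal_hodgeModel)
    (hI : hodgePQ_independent_of_hodgeModel) (h₁ : BallQuotientUniformised) (h₃ : CMAbelianVarietyRealised)
    (hR : DeligneMilne1982_Thm_6_20_full) :
    (picardCMUniverse hHD hI h₁ h₃).ModelAxioms :=
  modelAxioms_of_riemann hHD hI (ballQuotientUniformisedDatum_of h₁) h₃ hR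

end Model

end Summit.HodgeConjecture.CorCM

end
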